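import Mathlib.Analysis.SpecialFunctions.Gamma.Digamma
import Literature.NumberTheory.LFunctions.DirichletLRiemannHypothesisUpTo
import Literature.NumberTheory.LFunctions.WeilExplicitDirichlet
import HarnessLib

/-!
# Turing's method for Dirichlet `L`-functions as used by the certified GRH computations:
# `S_χ(t)`, the phase `θ_χ(t)`, the zero-count identity, and the printed bounds for `∫ S_χ`
# (Rumely 1993 Thm. 2; Booker 2006 Thm. 4.6, degree-one case) behind Platt 2016, §3

Topic `Literature/NumberTheory/LFunctions`; namespace `Literature.NumberTheory.LFunctions`.
Typed for the parity-realchar cell ("instrument provenance": the tree's `platt2016_theorem71`,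
`platt2016_theorem72`, `rumely1993_theorem4`, `bmor2021_lemma61a` of
`DirichletLRiemannHypothesisUpTo.lean` are certified computations whose rigour rests on the
zero-counting step recorded here), statement-first (D-0064): published results as named facts
(D-0014), no discharge attempted. This is the Dirichlet-`L` companion of the tree's `ζ`-layer
`TuringMethod.lean` (`zetaArgS`, `abs_integral_zetaArgS_le_turing/_trudgian/_trudgianII`).

## The objects (definitions, with the sources' conventions)

* `lfunctionArgS χ t` — **`S_χ(t) := (1/π) Im ∫_{∞}^{1/2} (L'_χ/L_χ)(σ + it) dσ`** (Booker 2006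
  (4–1) p. 394; Platt 2016 Thm. 3.2; Rumely 1993 §4 p. 426: "`S(t, χ) = (1/π) Im(ln L(s, χ))|^{s=1/2+it}`,
  the logarithm determined by analytic continuation along the horizontal line at height `t`").
  Typed as the Lebesgue integral over `σ ∈ (1/2, ∞)` of the imaginary part; for `t` not the
  ordinate of a zero this IS the printed quantity (the integrand is continuous and `O(2^{−σ})`).
  At the (countably many) ordinates of zeros the sources take the upper-semicontinuous value
  `S(t) = lim_{ε→0+} S(t+ε)`; the present definition may differ from that convention ONLY on this
  countable set, so every statement about `∫ S_χ(t) dt` — the only way `S_χ` enters Turing's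
  method and the only way it is used below — is literally the printed one, and the pointwise
  identity `rumely1993_eq3` is stated, as printed, only at non-ordinates.
* `lfunctionThetaDeriv χ`, `lfunctionTheta χ t` — **the phase `θ(t, χ)`** of Rumely §4 p. 426,
  `θ(t, χ) = (t/2) ln(q/π) + Im ln Γ((1/2 + δ + it)/2) + const` (`δ = a_χ` the parity,
  `charParity χ` of `WeilExplicitDirichlet.lean`), equivalently Booker's `πΦ(t)` ((4–7), with
  `r = 1`, `N = q`, `μ₁ = a_χ`) up to the additive constant `arg ε`: defined branch-free, exactly as
  the tree's `riemannSiegelTheta`, as `∫₀ᵗ θ'` with `θ'(u) = Re ψ((1/2 + a_χ + iu)/2)/2 + ln(q/π)/2`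
  (`ψ = Γ'/Γ = Complex.digamma`); only DIFFERENCES `θ(t₂) − θ(t₁)` occur below, so the
  normalisation `θ(0) = 0` is immaterial.
* `lfunctionZeroCountIoc χ t₁ t₂` — the number of zeros `ρ` of `L(s, χ)` with `0 < Re ρ < 1` and
  `t₁ < Im ρ ≤ t₂`, with multiplicity (`DirichletDisc.zeroOrder`), Rumely's `N(t, χ)|_{t₁}^{t₂}`,
  Booker's `N(t₁, t₂)`; the tree's two-sided `lfunctionZeroCount χ T` (`|Im ρ| ≤ T`) is the case
  `(−T, T]` when `−T` is not an ordinate.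
* `Booker2006Turing.smallZ`, `.bigZ`, `.turingConst` — Booker's `z₀(σ) = ζ(2σ)/ζ(σ)`,
  `Z₀(σ) = ζ(σ)` (Lemma 4.5 at `θ = 0`) and the constant `c₀` of Thm. 4.6 AS DISPLAYED:
  `c₀ = log Z₀(3/2) + ∫_{3/2}^∞ log(Z₀/z₀) − ∫_{3/2}^{5/2} log z₀ + (log 4)(z₀'/z₀)(3/2)`.

## The facts (statements AS PRINTED, specialised to Dirichlet `L`-functions where the source is
## more general)

* `rumely1993_eq3` — Rumely 1993, §4 eq. (3) p. 426 (= Booker 2006 (4–6)–(4–8) for `r = 1`; the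
  input of Platt 2016 Thm. 3.2): for primitive `χ` of conductor `q > 1` and `t₁ < t₂` that are not
  ordinates of zeros, `N(t, χ)|_{t₁}^{t₂} = (1/π) θ(t, χ)|_{t₁}^{t₂} + S(t, χ)|_{t₁}^{t₂}`.
* `rumely1993_theorem2` — Rumely 1993, Thm. 2 p. 429 (= Platt 2016 Thm. 3.3, = Platt's thesis
  Thm. 2.5.4): for `50 < t₁ < t₂`, `|∫_{t₁}^{t₂} S(t, χ) dt| ≤ 1.8397 + 0.1242 ln(q t₂/2π)`.
* `booker2006_theorem46_dirichlet` — Booker 2006, Thm. 4.6 p. 396 (arXiv Thm. 8) for an entire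
  degree-one `L`-function (`r = 1`, `N = q`, `μ₁ = a_χ`, no poles, Ramanujan exponent `θ = 0`):
  if `t₁², t₂² ≥ (5/2 + a_χ)² + X²` with `X > 5` (hypothesis (4–10)), then
  `π ∫_{t₁}^{t₂} S_χ ≤ ¼ log|Q(3/2 + it₂)| + (log 2 − ½) log|Q(3/2 + it₁)| + c₀ + 1/(√2 (X − 5))`,
  `|Q(3/2 + it)| = q |3/2 + a_χ + it| / 2π`, in either order of `t₁, t₂` (Remark 4.7).
  `-- TODO(general form):` Booker's theorem is for degree-`r` `L`-functions with poles on `Re s = 1`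
  and a Ramanujan exponent `θ < 1/2` (§1.3); only the case the Dirichlet computations use is typed.

NUMERICAL REMARK (recorded, not typed). Thm. 4.6 adds "(In particular, `c₀ ⪅ 5.65055`.)". Evaluating
the displayed formula gives `c₀ ≈ 4.6903 = 5.65055 − log ζ(3/2)` (this seat's numerics; the proof on
pp. 396–397 — `½ log B ≤ r log Z_θ(3/2)` once — supports the displayed formula); under either reading
`c₀ ≤ 5.65055`, so a consumer may use `5.65055` safely. We type the displayed definition.

NOT typed here: Platt 2016 Thm. 3.2 (the conjugate-pair, integrated form of `rumely1993_eq3` — a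
bookkeeping corollary whose display is garbled in both held renderings; its content is (3) for `χ`
and `χ̄` integrated over `[t₀, t₀ + h]`); Rumely's Gram-scale Thm. 1; Trudgian's unpublished constants
`2.17618, 0.0679955` (Platt 2016 p. 5, "personal communication"); Booker §3 (explicit-formula zero
location), §5 (rigorous FFT evaluation, Platt's Lemma 5.4) and Lemmas 4.1–4.5.

`lean search` (2026-08-26): no `S_χ`, `θ_χ` or windowed zero count for Dirichlet `L` in the tree; the
constants `1.8397`, `0.1242`, `5.65055` occur nowhere; `charParity`, `DirichletDisc.zeroOrder`,
`lfunctionZeroBox/Count`, `LFunctionRHUpTo` are reused, not re-declared.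

## References

* [Rumely1993ERH] R. Rumely, *Numerical computations concerning the ERH*, Math. Comp. 61 (1993)
  415–440: §4 pp. 426–429, eq. (3), Theorem 2 (held `paper:doi-10-1090-s0025-5718-1993-1195435-0`,
  pp. 12, 15).
* [Booker2006] A. R. Booker, *Artin's conjecture, Turing's method, and the Riemann hypothesis*,
  Experiment. Math. 15 (2006) 385–407: §4 (4–1), (4–6)–(4–8), (4–10), Lemma 4.5, Theorem 4.6,
  Remark 4.7, pp. 394–397 (journal pdf held as `paper:url-702ab4eacdaa` p. 12; arXiv:math/0507502 =
  `paper:arxiv-math_0507502`, there Theorem 8).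
* [Platt2016GRH] D. J. Platt, *Numerical computations concerning the GRH*, Math. Comp. 85 (2016)
  3009–3027, §3 Theorems 3.1–3.3 (held arXiv:1305.3087 pp. 4–5); D. J. Platt, *Computing degree 1
  L-functions rigorously*, PhD thesis, Bristol 2011, §2.5 Thms. 2.5.3–2.5.4 (held `paper:url-5d24a55cc2a3`
  pp. 11–12).
-/

noncomputable section

open Complex Set MeasureTheory intervalIntegral
open scoped Real

namespace Literature.NumberTheory.LFunctions

variable {q : ℕ}

/-! ### The phase `θ(t, χ)` -/

/-- The derivative of Rumely's phase: `θ'(u, χ) = Re ψ((1/2 + a_χ + iu)/2)/2 + ln(q/π)/2`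
(`ψ = Γ'/Γ`; differentiate `θ(t, χ) = (t/2) ln(q/π) + Im ln Γ((1/2 + a_χ + it)/2)`, Rumely §4 p. 426,
along the vertical line). [cite: Rumely1993ERH, §4 p. 426 (definition of θ(t, χ))] -/
def lfunctionThetaDeriv (χ : DirichletCharacter ℂ q) (u : ℝ) : ℝ :=
  (Complex.digamma ((1 / 2 + (charParity χ : ℂ) + (u : ℂ) * I) / 2)).re / 2 +
    Real.log ((q : ℝ) / π) / 2

/-- **Rumely's phase `θ(t, χ)`**, branch-free: `θ(t, χ) := ∫₀ᵗ θ'(u, χ) du`, i.e.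
`(t/2) ln(q/π) + Im ln Γ((1/2 + a_χ + it)/2)` by continuous variation, normalised by `θ(0, χ) = 0`
(the source's additive constant is immaterial: only differences `θ(t₂, χ) − θ(t₁, χ)` are used). Equals
`π Φ(t)` of Booker (4–7) (`r = 1`, `N = q`, `μ₁ = a_χ`) up to the constant `arg ε`.
[cite: Rumely1993ERH, §4 p. 426 (definition of θ(t, χ))] -/
def lfunctionTheta (χ : DirichletCharacter ℂ q) (t : ℝ) : ℝ :=
  ∫ u in (0 : ℝ)..t, lfunctionThetaDeriv χ u

variable [NeZero q]

/-! ### `S_χ(t)` -/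

/-- **`S_χ(t) = (1/π) Im ∫_{∞}^{1/2} (L'_χ/L_χ)(σ + it) dσ`** (Booker 2006 (4–1); Platt 2016 Thm. 3.2;
Rumely 1993 §4: `(1/π) Im ln L(1/2 + it, χ)` by continuation along the horizontal line from `+∞`),
typed as minus the Lebesgue integral over `σ > 1/2` of `Im (L'_χ/L_χ)(σ + it)`. For `t` not the
ordinate of a zero of `L(s, χ)` this is the printed value; at ordinates the sources use the
upper-semicontinuous regularisation, from which this definition can differ only on that countable
set — immaterial for all `∫ S_χ(t) dt` statements (see the module docstring).
[cite: Booker2006, §4 (4–1) p. 394] -/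
def lfunctionArgS (χ : DirichletCharacter ℂ q) (t : ℝ) : ℝ :=
  -(1 / π * ∫ σ in Ioi (1 / 2 : ℝ),
    (deriv χ.LFunction ((σ : ℂ) + (t : ℂ) * I) / χ.LFunction ((σ : ℂ) + (t : ℂ) * I)).im)

/-! ### Zeros in a window of heights -/

/-- `N(t, χ)|_{t₁}^{t₂}`: the number of zeros `ρ` of `L(s, χ)` with `0 < Re ρ < 1` and
`t₁ < Im ρ ≤ t₂`, counted with multiplicity (`DirichletDisc.zeroOrder χ = analyticOrderNatAt`) —
Rumely's "number of zeros of `L(s, χ)` in the critical strip with ordinates between `t₁` and `t₂`"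
(eq. (3)), Booker's `N(t₁, t₂)` (§4 p. 394, "imaginary part in `(t₁, t₂]`").
[cite: Booker2006, §4 p. 394 (definition of N(t₁, t₂))] -/
def lfunctionZeroCountIoc (χ : DirichletCharacter ℂ q) (t₁ t₂ : ℝ) : ℕ :=
  ∑ᶠ ρ ∈ {ρ : ℂ | χ.LFunction ρ = 0 ∧ 0 < ρ.re ∧ ρ.re < 1 ∧ t₁ < ρ.im ∧ ρ.im ≤ t₂},
    DirichletDisc.zeroOrder χ ρ

/-! ### Booker's constants for degree one (`θ = 0`) -/

namespace Booker2006Turing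

/-- Booker's `z_θ(σ)` at `θ = 0`: `z₀(σ) = (ζ(2σ)²/ζ(σ)²)^{1/2} = ζ(2σ)/ζ(σ)` (`σ > 1`; real), the
lower Euler-product envelope `z₀(σ)^r ≤ |L(σ + it)|` of Lemma 4.5.
[cite: Booker2006, §4 Lemma 4.5 p. 396] -/
def smallZ (σ : ℝ) : ℝ :=
  (riemannZeta (2 * (σ : ℂ)) / riemannZeta (σ : ℂ)).re

/-- Booker's `Z_θ(σ)` at `θ = 0`: `Z₀(σ) = ζ(σ)` (`σ > 1`; real), the upper envelope
`|L(σ + it)| ≤ Z₀(σ)^r` of Lemma 4.5. [cite: Booker2006, §4 Lemma 4.5 p. 396] -/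
def bigZ (σ : ℝ) : ℝ :=
  (riemannZeta (σ : ℂ)).re

/-- **Booker's constant `c_θ` at `θ = 0`, AS DISPLAYED in Thm. 4.6:**
`c₀ = log Z₀(3/2) + ∫_{3/2}^∞ log(Z₀(σ)/z₀(σ)) dσ − ∫_{3/2}^{5/2} log z₀(σ) dσ + (log 4)(z₀'/z₀)(3/2)`.
(The paper adds "in particular `c₀ ⪅ 5.65055`"; the displayed expression evaluates to `≈ 4.6903 =
5.65055 − log ζ(3/2)` — see the module docstring; `c₀ ≤ 5.65055` under either reading.)
[cite: Booker2006, §4 Theorem 4.6 p. 396] -/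
def turingConst : ℝ :=
  Real.log (bigZ (3 / 2)) + (∫ σ in Ioi (3 / 2 : ℝ), Real.log (bigZ σ / smallZ σ)) -
    (∫ σ in (3 / 2 : ℝ)..(5 / 2), Real.log (smallZ σ)) + Real.log 4 * (deriv smallZ (3 / 2) / smallZ (3 / 2))

end Booker2006Turing

/-! ### Named facts -/

/-- **Rumely 1993, §4 eq. (3) (p. 426), as printed:** for a primitive Dirichlet `L`-series of conductor
`q > 1` and `t₁ < t₂` such that "`L(s, χ)` has no zeros at height `t₁` or `t₂`",
"`N(t, χ)|_{t₁}^{t₂} = (1/π) θ(t, χ)|_{t₁}^{t₂} + S(t, χ)|_{t₁}^{t₂}`, where `N(t, χ)|_{t₁}^{t₂}` is the number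
of zeros of `L(s, χ)` in the critical strip with ordinates between `t₁` and `t₂`" (argument principle
for the completed `L`-function; Booker 2006 (4–6)–(4–8) is the same identity for his class, `N(t₁, t₂)
= (1/π) Im log γ(s)|_{1/2+it₁}^{1/2+it₂} + S(t₂) − S(t₁)`, and Platt 2016 Thm. 3.2 integrates it for the
pair `χ, χ̄`). With the branch-free `lfunctionTheta` (continuous variation) and `lfunctionArgS` at
non-ordinates the two sides are exactly the printed ones. Not discharged here (size M: argument
principle + Stirling-free bookkeeping, cf. the tree's `ζ` analogue built into `zetaArgS`).
[cite: Rumely1993ERH, §4 eq. (3) p. 426] -/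
def rumely1993_eq3 : Prop :=
  ∀ (q : ℕ) [NeZero q], 1 < q → ∀ χ : DirichletCharacter ℂ q, χ.IsPrimitive →
    ∀ ⦃t₁ t₂ : ℝ⦄, t₁ < t₂ → (∀ s : ℂ, χ.LFunction s = 0 → s.im ≠ t₁ ∧ s.im ≠ t₂) →
      (lfunctionZeroCountIoc χ t₁ t₂ : ℝ) =
        (lfunctionTheta χ t₂ - lfunctionTheta χ t₁) / π + (lfunctionArgS χ t₂ - lfunctionArgS χ t₁)

/-- **Rumely 1993, Theorem 2 (p. 429), as printed:** in the setting of §4 (a primitive Dirichlet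
`L`-series `L(s, χ)` of conductor `q > 1`), "For `50 < t₁ < t₂`,
`|∫_{t₁}^{t₂} S(t, χ) dt| ≤ 1.8397 + .1242 ln(q t₂ / 2π)`." (Relation `≤` confirmed on the page
image of p. 429, rendered 2026-08-28 from the held scan; an earlier version of this docstring quoted `<`
after the OCR text layer.) Restated by Platt (Math. Comp. 85 (2016) Thm. 3.3; thesis Thm. 2.5.4: "For
`T > 50` and `h > 0`, `|∫_T^{T+h} S_χ(t) dt| ≤ 1.8397 + 0.1242 log(q(T + h)/2π)`"), with the same
non-strict `≤`, which is typed. The bound that makes Turing's method for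
Dirichlet `L`-functions effective (it certifies that no zero was missed); proved in the source from
Littlewood's lemma (Lemma 3) and explicit estimates for `ln|L|` on `Re s ≥ 1/2` (Lemmas 4–6,
pp. 429–432). Not discharged in this file.  DISCHARGED 2026-08-27 with the printed constants:
`rumely1993_theorem2_holds` (`CertifiedDirichletLTuringRumelyTheorem2.lean`, computational node: derived
from Trudgian's Theorem 3.8 for one character at `(c, d) = (5/4, 1)`, where `a ≈ 1.793 ≤ 1.8397` and
`b ≈ 0.106 ≤ 0.1242`, with certified values of `log ζ`).  KERNEL-PROVED REPLACEMENTS (2026-08-27):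
the whole argument is formalised in the pair form `∫S(t,χ)dt + ∫S(t,χ̄)dt` that Turing's method consumes —
Littlewood's lemma `TuringDirichlet.pi_mul_integral_lfunctionArgS_eq`
(`CertifiedDirichletLTuringMethodZeroCountProofs.lean`), Rademacher's Lemma 4
(`RademacherDirichletLConvexity.lean`), Trudgian's sharpening of Lemmas 5–6 (Trudgian 2011, Lemmas
3.6–3.7: `CertifiedDirichletLTuringTrudgianProofs.lean`, `CertifiedDirichletLTuringLowerBound.lean`,
`CertifiedDirichletLTuringHadamard.lean`), assembled UNCONDITIONALLY as
`TuringDirichlet.pi_mul_integral_lfunctionArgS_pair_le'` and numerically as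
`TuringDirichlet.integral_lfunctionArgS_pair_le_numeric` (`∫S_χ + ∫S_χ̄ ≤ 2(2.26 + 0.0642 log(qt₂/2π))`,
`CertifiedDirichletLTuringHolds.lean`); the verification step is `LFunctionRHUpTo.of_turing_trudgian` /
`LFunctionRHUpTo.of_turing_numeric`. [cite: Rumely1993ERH, Theorem 2 p. 429] -/
def rumely1993_theorem2 : Prop :=
  ∀ (q : ℕ) [NeZero q], 1 < q → ∀ χ : DirichletCharacter ℂ q, χ.IsPrimitive →
    ∀ ⦃t₁ t₂ : ℝ⦄, 50 < t₁ → t₁ < t₂ →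
      abs (∫ t in t₁..t₂, lfunctionArgS χ t) ≤ 1.8397 + 0.1242 * Real.log (q * t₂ / (2 * π))

/-- **Booker 2006, Theorem 4.6 (p. 396; arXiv:math/0507502 Thm. 8) — the degree-one entire case, as
printed after specialisation.** Booker's class (§1.3): `L(s) = Π_p (1 − α_p p^{−s})^{−1}`,
`γ(s) = ε N^{(s − 1/2)/2} Γ_ℝ(s + μ₁)`, `Λ = γL` with `Λ(s) = \overline{Λ}(1 − s)`, `Q(s) = N(s + μ₁)/2π`;
for `L = L(·, χ)`, `χ` primitive of conductor `q > 1`: `r = 1`, `N = q`, `μ₁ = a_χ ∈ {0, 1}`, no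
poles (`m = 0`), and (1–4) holds with `θ = 0` (`|χ(p)| ≤ 1`, `Re μ₁ ≥ 0`). Hypothesis (4–10):
"`(t + Im μ_j)² ≥ (5/2 + Re μ_j)² + X²` for some `X > 5` and all `j`", at `t = t₁` and `t = t₂`.
Conclusion: "`π ∫_{t₁}^{t₂} S(t) dt ≤ ¼ log|Q(3/2 + it₂)| + (log 2 − ½) log|Q(3/2 + it₁)| + c_θ r +
r/(√2 (X − 5))`" with `|Q(3/2 + it)| = q |3/2 + a_χ + it| / 2π` and `c₀ = Booker2006Turing.turingConst`;
"there is no assumption on the order of `t₁` and `t₂`, so one obtains a lower bound as well by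
reversing their roles" (Remark 4.7) — the interval integral below is the oriented one. Not discharged
in this file (size L: Phragmén–Lindelöf (Lemma 4.1), Stirling-type bounds (4.3), the Hadamard product and
the computational Lemma 4.4); DISCHARGED 2026-08-27: `booker2006_theorem46_dirichlet_holds`
(`CertifiedDirichletLTuringBooker.lean`). [cite: Booker2006, §4 Theorem 4.6 and Remark 4.7, p. 396] -/
-- TODO(general form): Booker's Thm. 4.6 is stated for degree-`r` `L`-functions of his class with at
-- most `r` poles on `Re s = 1` and a Ramanujan exponent `θ < 1/2` (constant `c_θ r`); only the
-- entire degree-one case used by the Dirichlet computations (Platt 2016 Thm. 3.1) is typed.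
-- ERRATUM (recorded 2026-08-27): Palojärvi–Zhao, arXiv:2508.03023v2 §4 Remark 4.2, report that the last
-- inequality of Booker's proof holds only for `5 < X < 10.5998`; the statement PROVED IN PRINT for all
-- `X > 5` carries `0.8 r/(X − 5)` in place of `r/(√2 (X − 5))` — see the section «Erratum» at the end of
-- this file (`palojarviZhao2025_theorem46_dirichlet`, weaker than the fact below:
-- `booker2006_theorem46_dirichlet.corrected`).  The fact below is kept AS PRINTED.
-- RESOLVED (2026-08-27): in the degree-one ENTIRE case typed here (`m = 0`, no poles) Booker's last
-- inequality `r(1/(√2X) + ((2/π²)log(16e³)+¼)/X²) < r/(√2(X−5))` holds for EVERY `X > 5` (it reads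
-- `1.42(X − 5) < 3.54X`); the window `5 < X < 10.5998` of Palojärvi–Zhao's Remark 4.2 comes from the pole
-- terms `m(4 log 2 + 5/2)/X²`.  The fact below is PROVED as printed: `booker2006_theorem46_dirichlet_holds`
-- (`CertifiedDirichletLTuringBooker.lean`, standard axioms), hence also `palojarviZhao2025_theorem46_dirichlet_holds`.
def booker2006_theorem46_dirichlet : Prop :=
  ∀ (q : ℕ) [NeZero q], 1 < q → ∀ χ : DirichletCharacter ℂ q, χ.IsPrimitive →
    ∀ (X t₁ t₂ : ℝ), 5 < X →
      (5 / 2 + (charParity χ : ℝ)) ^ 2 + X ^ 2 ≤ t₁ ^ 2 →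
      (5 / 2 + (charParity χ : ℝ)) ^ 2 + X ^ 2 ≤ t₂ ^ 2 →
        π * ∫ t in t₁..t₂, lfunctionArgS χ t ≤
          1 / 4 * Real.log (q * ‖(3 / 2 : ℂ) + (charParity χ : ℂ) + (t₂ : ℂ) * I‖ / (2 * π)) +
            (Real.log 2 - 1 / 2) *
              Real.log (q * ‖(3 / 2 : ℂ) + (charParity χ : ℂ) + (t₁ : ℂ) * I‖ / (2 * π)) +
            Booker2006Turing.turingConst + 1 / (Real.sqrt 2 * (X - 5))

/-! ### Elementary consequences (proved; appended 2026-08-26) -/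

omit [NeZero q] in
/-- Normalisation `θ(0, χ) = 0` of the branch-free phase (the source's `θ(t, χ)` is fixed only up to
the additive constant that cancels in (3)). [cite: Rumely1993ERH, §4 p. 426 (definition of θ(t, χ))] -/
@[simp]
theorem lfunctionTheta_zero (χ : DirichletCharacter ℂ q) : lfunctionTheta χ 0 = 0 := by
  simp [lfunctionTheta]

omit [NeZero q] in
/-- The phase difference entering (3): `θ(t, χ)|_{a}^{b} = ∫ₐᵇ θ'(u, χ) du`, when `θ'` is interval
integrable from `0` (it is continuous; not proved here). [cite: Rumely1993ERH, §4 eq. (3) p. 426] -/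
theorem lfunctionTheta_sub (χ : DirichletCharacter ℂ q) {a b : ℝ}
    (ha : IntervalIntegrable (lfunctionThetaDeriv χ) volume 0 a)
    (hb : IntervalIntegrable (lfunctionThetaDeriv χ) volume 0 b) :
    lfunctionTheta χ b - lfunctionTheta χ a = ∫ u in a..b, lfunctionThetaDeriv χ u := by
  unfold lfunctionTheta
  rw [← integral_add_adjacent_intervals ha.symm hb, integral_symm a 0]
  ring

/-- The window of Booker's `N(t₁, t₂)` is contained in the tree's two-sided box of height
`max |t₁| |t₂|` (`lfunctionZeroBox`, Platt's `N_χ(t₀)` box), hence is finite for `χ ≠ χ₀`.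
[cite: Booker2006, §4 p. 394 (definition of N(t₁, t₂))] -/
theorem zeroWindow_subset_lfunctionZeroBox (χ : DirichletCharacter ℂ q) (t₁ t₂ : ℝ) :
    {ρ : ℂ | χ.LFunction ρ = 0 ∧ 0 < ρ.re ∧ ρ.re < 1 ∧ t₁ < ρ.im ∧ ρ.im ≤ t₂} ⊆
      lfunctionZeroBox χ (max |t₁| |t₂|) := by
  intro ρ hρ
  rcases hρ with ⟨h0, h1, h2, h3, h4⟩
  refine (mem_lfunctionZeroBox).2 ⟨h0, h1, h2, ?_⟩
  rcases le_or_gt 0 ρ.im with hi | hi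
  · rw [abs_of_nonneg hi]
    exact h4.trans ((le_abs_self t₂).trans (le_max_right _ _))
  · rw [abs_of_neg hi]
    have : -ρ.im ≤ |t₁| := by
      have := neg_le_abs t₁
      linarith
    exact this.trans (le_max_left _ _)

/-- The window set is finite for a non-principal character (`lfunctionZeroBox_finite`).
[cite: Booker2006, §4 p. 394 (definition of N(t₁, t₂))] -/
theorem zeroWindow_finite {χ : DirichletCharacter ℂ q} (hχ : χ ≠ 1) (t₁ t₂ : ℝ) :
    {ρ : ℂ | χ.LFunction ρ = 0 ∧ 0 < ρ.re ∧ ρ.re < 1 ∧ t₁ < ρ.im ∧ ρ.im ≤ t₂}.Finite :=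
  (lfunctionZeroBox_finite hχ _).subset (zeroWindow_subset_lfunctionZeroBox χ t₁ t₂)

/-- Rumely's bound in Turing's working form (Platt 2016 Thm. 3.3's shape): for `50 < T` and `0 < h`,
`∫_T^{T+h} S(t, χ) dt ≤ 1.8397 + 0.1242 ln(q(T + h)/2π)`. [cite: Platt2016GRH, Theorem 3.3] -/
theorem rumely1993_theorem2.integral_le (h : rumely1993_theorem2) {q : ℕ} [NeZero q] (hq : 1 < q)
    {χ : DirichletCharacter ℂ q} (hχ : χ.IsPrimitive) {T h' : ℝ} (hT : 50 < T) (hh : 0 < h') :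
    ∫ t in T..T + h', lfunctionArgS χ t ≤ 1.8397 + 0.1242 * Real.log (q * (T + h') / (2 * π)) :=
  (le_abs_self _).trans (h q hq χ hχ hT (by linarith))

/-- The lower companion in Turing's working form: `−(1.8397 + 0.1242 ln(q(T + h)/2π)) ≤ ∫_T^{T+h} S`.
[cite: Platt2016GRH, Theorem 3.3] -/
theorem rumely1993_theorem2.neg_le_integral (h : rumely1993_theorem2) {q : ℕ} [NeZero q] (hq : 1 < q)
    {χ : DirichletCharacter ℂ q} (hχ : χ.IsPrimitive) {T h' : ℝ} (hT : 50 < T) (hh : 0 < h') :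
    -(1.8397 + 0.1242 * Real.log (q * (T + h') / (2 * π))) ≤ ∫ t in T..T + h', lfunctionArgS χ t :=
  neg_le_of_abs_le (h q hq χ hχ hT (by linarith))

/-- **Remark 4.7**: Booker's bound with `t₁, t₂` interchanged gives the LOWER bound
`−(¼ log|Q(3/2+it₁)| + (log 2 − ½) log|Q(3/2+it₂)| + c₀ + 1/(√2(X−5))) ≤ π ∫_{t₁}^{t₂} S_χ`.
[cite: Booker2006, §4 Remark 4.7 p. 396] -/
theorem booker2006_theorem46_dirichlet.lower (h : booker2006_theorem46_dirichlet) {q : ℕ} [NeZero q]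
    (hq : 1 < q) {χ : DirichletCharacter ℂ q} (hχ : χ.IsPrimitive) {X t₁ t₂ : ℝ} (hX : 5 < X)
    (h₁ : (5 / 2 + (charParity χ : ℝ)) ^ 2 + X ^ 2 ≤ t₁ ^ 2)
    (h₂ : (5 / 2 + (charParity χ : ℝ)) ^ 2 + X ^ 2 ≤ t₂ ^ 2) :
    -(1 / 4 * Real.log (q * ‖(3 / 2 : ℂ) + (charParity χ : ℂ) + (t₁ : ℂ) * I‖ / (2 * π)) +
        (Real.log 2 - 1 / 2) *
          Real.log (q * ‖(3 / 2 : ℂ) + (charParity χ : ℂ) + (t₂ : ℂ) * I‖ / (2 * π)) +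
        Booker2006Turing.turingConst + 1 / (Real.sqrt 2 * (X - 5))) ≤
      π * ∫ t in t₁..t₂, lfunctionArgS χ t := by
  have h' := h q hq χ hχ X t₂ t₁ hX h₂ h₁
  rw [integral_symm, mul_neg] at h'
  linarith

/-- **Two-sided Turing window**: under hypothesis (4–10) at `t₁, t₂`, Booker's theorem pins
`π ∫_{t₁}^{t₂} S_χ` in an explicit interval of length
`(log 2 − ¼)(log|Q(3/2+it₁)| + log|Q(3/2+it₂)|) + 2c₀ + 2/(√2(X−5))` — the quantity that must be
`< π h` (after subtracting the phase and the found zeros) for Turing's method to certify a zero count.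
[cite: Booker2006, §4 Theorem 4.6 and Remark 4.7, p. 396] -/
theorem booker2006_theorem46_dirichlet.abs_window (h : booker2006_theorem46_dirichlet) {q : ℕ} [NeZero q]
    (hq : 1 < q) {χ : DirichletCharacter ℂ q} (hχ : χ.IsPrimitive) {X t₁ t₂ : ℝ} (hX : 5 < X)
    (h₁ : (5 / 2 + (charParity χ : ℝ)) ^ 2 + X ^ 2 ≤ t₁ ^ 2)
    (h₂ : (5 / 2 + (charParity χ : ℝ)) ^ 2 + X ^ 2 ≤ t₂ ^ 2) :
    -(1 / 4 * Real.log (q * ‖(3 / 2 : ℂ) + (charParity χ : ℂ) + (t₁ : ℂ) * I‖ / (2 * π)) +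
          (Real.log 2 - 1 / 2) * Real.log (q * ‖(3 / 2 : ℂ) + (charParity χ : ℂ) + (t₂ : ℂ) * I‖ / (2 * π)) +
          Booker2006Turing.turingConst + 1 / (Real.sqrt 2 * (X - 5))) ≤
        (π * ∫ t in t₁..t₂, lfunctionArgS χ t) ∧
      (π * ∫ t in t₁..t₂, lfunctionArgS χ t) ≤
        1 / 4 * Real.log (q * ‖(3 / 2 : ℂ) + (charParity χ : ℂ) + (t₂ : ℂ) * I‖ / (2 * π)) +
          (Real.log 2 - 1 / 2) * Real.log (q * ‖(3 / 2 : ℂ) + (charParity χ : ℂ) + (t₁ : ℂ) * I‖ / (2 * π)) +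
          Booker2006Turing.turingConst + 1 / (Real.sqrt 2 * (X - 5)) :=
  ⟨booker2006_theorem46_dirichlet.lower h hq hχ hX h₁ h₂, h q hq χ hχ X t₁ t₂ hX h₁ h₂⟩

/-! ### Erratum to Theorem 4.6 (Palojärvi–Zhao 2025, §4 Remark 4.2) — appended 2026-08-27

N. Palojärvi, T. Zhao, *On Turing's method for a general set of `L`-functions and the Selberg class*,
arXiv:2508.03023v2 (2025; preprint), §4 **Remark 4.2** (label `rmk:mistake`, checked on the TeX source):
«We note that there is a small mistake in [Booker2006, Theorem 4.6]. The last inequality of the proof holds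
only if `5 < X < 10.5998`, not for all `X > 5` as assumed in [Booker2006, Theorem 4.6]. However, the theorem is
valid if we replace `r/(√2(X−5))` by `0.8r/(X−5)`.»  (§2.2 adds: «due to Remark 4.2, the term `2/(√2(X−5))` in
[BT2018, Theorem 7.1] should be replaced by `1.6/(X−5)`»; their Theorems 2.1–2.3 improve Booker's bound for
`t₁, t₂` large.)  Consequently the named fact `booker2006_theorem46_dirichlet` above (typed AS PRINTED: every
`X > 5`, last term `1/(√2(X − 5))`) is, on Palojärvi–Zhao's reading, supported by the printed proof
only for `5 < X < 10.5998` (but see the RESOLVED note at that fact: with no poles the printed last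
inequality holds for all `X > 5`, and the fact is now PROVED, `booker2006_theorem46_dirichlet_holds`); the
statement PZ give for all `X > 5` is the one below with `0.8/(X − 5)` (CLAIM label, D-0012: the correction is a
preprint's), and it is WEAKER (`booker2006_theorem46_dirichlet.corrected`: `1/√2 < 0.8`).  The Dirichlet
computations of record do not depend on this constant: Platt 2016 used Trudgian's bound (`platt2016_theorem54`,
`trudgian2011_theorem33/38`, `rumely1993_theorem2`).
[cite: PalojarviZhao2025TuringSelbergClass, §4 Remark 4.2] [cite: Booker2006, §4 Theorem 4.6 p. 396] -/

/-- **Booker 2006 Theorem 4.6 (degree-one entire case) AS CORRECTED by Palojärvi–Zhao 2025, Remark 4.2:**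
same hypotheses as `booker2006_theorem46_dirichlet` (primitive `χ` of conductor `q > 1`, `X > 5`,
(4–10) at `t₁` and `t₂`), conclusion
`π ∫_{t₁}^{t₂} S_χ ≤ ¼ log|Q(3/2 + it₂)| + (log 2 − ½) log|Q(3/2 + it₁)| + c₀ + 0.8/(X − 5)` («the theorem is
valid if we replace `r/(√2(X−5))` by `0.8r/(X−5)`», `r = 1`).  CLAIM (arXiv:2508.03023v2, a preprint).
DISCHARGED 2026-08-27: `palojarviZhao2025_theorem46_dirichlet_holds` (`CertifiedDirichletLTuringBooker.lean`,
via `booker2006_theorem46_dirichlet_holds` and `.corrected`: for `m = 0` the printed bound itself holds).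
[cite: PalojarviZhao2025TuringSelbergClass, §4 Remark 4.2] [cite: Booker2006, §4 Theorem 4.6 p. 396] -/
def palojarviZhao2025_theorem46_dirichlet : Prop :=
  ∀ (q : ℕ) [NeZero q], 1 < q → ∀ χ : DirichletCharacter ℂ q, χ.IsPrimitive →
    ∀ (X t₁ t₂ : ℝ), 5 < X →
      (5 / 2 + (charParity χ : ℝ)) ^ 2 + X ^ 2 ≤ t₁ ^ 2 →
      (5 / 2 + (charParity χ : ℝ)) ^ 2 + X ^ 2 ≤ t₂ ^ 2 →
        π * ∫ t in t₁..t₂, lfunctionArgS χ t ≤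
          1 / 4 * Real.log (q * ‖(3 / 2 : ℂ) + (charParity χ : ℂ) + (t₂ : ℂ) * I‖ / (2 * π)) +
            (Real.log 2 - 1 / 2) *
              Real.log (q * ‖(3 / 2 : ℂ) + (charParity χ : ℂ) + (t₁ : ℂ) * I‖ / (2 * π)) +
            Booker2006Turing.turingConst + 0.8 / (X - 5)

/-- `1/(√2 (X − 5)) ≤ 0.8/(X − 5)` for `X > 5` (`1/√2 = 0.7071… < 0.8`): the corrected last term dominates
the printed one. [cite: PalojarviZhao2025TuringSelbergClass, §4 Remark 4.2] -/
theorem Booker2006Turing.inv_sqrt_two_mul_le {X : ℝ} (hX : 5 < X) :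
    1 / (Real.sqrt 2 * (X - 5)) ≤ 0.8 / (X - 5) := by
  have hX5 : 0 < X - 5 := by linarith
  have hs : (1.25 : ℝ) ≤ Real.sqrt 2 := by
    rw [show (1.25 : ℝ) = Real.sqrt (1.25 ^ 2) by rw [Real.sqrt_sq (by norm_num)]]
    exact Real.sqrt_le_sqrt (by norm_num)
  rw [div_le_div_iff₀ (by positivity) hX5]
  nlinarith

/-- **The printed statement implies the corrected one** (the correction WEAKENS Theorem 4.6: the fact
`booker2006_theorem46_dirichlet`, as printed, is the stronger claim whose printed proof has the gap).
[cite: PalojarviZhao2025TuringSelbergClass, §4 Remark 4.2] -/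
theorem booker2006_theorem46_dirichlet.corrected (h : booker2006_theorem46_dirichlet) :
    palojarviZhao2025_theorem46_dirichlet := by
  intro q _ hq χ hχ X t₁ t₂ hX h₁ h₂
  have h' := h q hq χ hχ X t₁ t₂ hX h₁ h₂
  have hle := Booker2006Turing.inv_sqrt_two_mul_le hX
  linarith

/-- Remark 4.7 for the corrected bound: reversing `t₁, t₂` gives the lower bound
`−(¼ log|Q(3/2+it₁)| + (log 2 − ½) log|Q(3/2+it₂)| + c₀ + 0.8/(X−5)) ≤ π ∫_{t₁}^{t₂} S_χ`.
[cite: Booker2006, §4 Remark 4.7 p. 396] [cite: PalojarviZhao2025TuringSelbergClass, §4 Remark 4.2] -/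
theorem palojarviZhao2025_theorem46_dirichlet.lower (h : palojarviZhao2025_theorem46_dirichlet) {q : ℕ}
    [NeZero q] (hq : 1 < q) {χ : DirichletCharacter ℂ q} (hχ : χ.IsPrimitive) {X t₁ t₂ : ℝ} (hX : 5 < X)
    (h₁ : (5 / 2 + (charParity χ : ℝ)) ^ 2 + X ^ 2 ≤ t₁ ^ 2)
    (h₂ : (5 / 2 + (charParity χ : ℝ)) ^ 2 + X ^ 2 ≤ t₂ ^ 2) :
    -(1 / 4 * Real.log (q * ‖(3 / 2 : ℂ) + (charParity χ : ℂ) + (t₁ : ℂ) * I‖ / (2 * π)) +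
        (Real.log 2 - 1 / 2) *
          Real.log (q * ‖(3 / 2 : ℂ) + (charParity χ : ℂ) + (t₂ : ℂ) * I‖ / (2 * π)) +
        Booker2006Turing.turingConst + 0.8 / (X - 5)) ≤
      π * ∫ t in t₁..t₂, lfunctionArgS χ t := by
  have h' := h q hq χ hχ X t₂ t₁ hX h₂ h₁
  rw [integral_symm, mul_neg] at h'
  linarith

/-- Two-sided Turing window for the corrected bound (cf. `booker2006_theorem46_dirichlet.abs_window`).
[cite: Booker2006, §4 Theorem 4.6 and Remark 4.7, p. 396] [cite: PalojarviZhao2025TuringSelbergClass, §4 Remark 4.2] -/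
theorem palojarviZhao2025_theorem46_dirichlet.abs_window (h : palojarviZhao2025_theorem46_dirichlet) {q : ℕ}
    [NeZero q] (hq : 1 < q) {χ : DirichletCharacter ℂ q} (hχ : χ.IsPrimitive) {X t₁ t₂ : ℝ} (hX : 5 < X)
    (h₁ : (5 / 2 + (charParity χ : ℝ)) ^ 2 + X ^ 2 ≤ t₁ ^ 2)
    (h₂ : (5 / 2 + (charParity χ : ℝ)) ^ 2 + X ^ 2 ≤ t₂ ^ 2) :
    -(1 / 4 * Real.log (q * ‖(3 / 2 : ℂ) + (charParity χ : ℂ) + (t₁ : ℂ) * I‖ / (2 * π)) +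
          (Real.log 2 - 1 / 2) * Real.log (q * ‖(3 / 2 : ℂ) + (charParity χ : ℂ) + (t₂ : ℂ) * I‖ / (2 * π)) +
          Booker2006Turing.turingConst + 0.8 / (X - 5)) ≤
        (π * ∫ t in t₁..t₂, lfunctionArgS χ t) ∧
      (π * ∫ t in t₁..t₂, lfunctionArgS χ t) ≤
        1 / 4 * Real.log (q * ‖(3 / 2 : ℂ) + (charParity χ : ℂ) + (t₂ : ℂ) * I‖ / (2 * π)) +
          (Real.log 2 - 1 / 2) * Real.log (q * ‖(3 / 2 : ℂ) + (charParity χ : ℂ) + (t₁ : ℂ) * I‖ / (2 * π)) +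
          Booker2006Turing.turingConst + 0.8 / (X - 5) :=
  ⟨palojarviZhao2025_theorem46_dirichlet.lower h hq hχ hX h₁ h₂, h q hq χ hχ X t₁ t₂ hX h₁ h₂⟩


end Literature.NumberTheory.LFunctions

end
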